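import Summits.QuantumFields.YangMills.Theorems.AlphaInputsT3ACv3EMLIterFirstOrderUniformAllL
import Summits.QuantumFields.YangMills.Theorems.AlphaInputsT3ACv3EMLTwoFieldIterUniform
import HarnessLib

/-!
# `AlphaInputsT3ACv3EMLTwoFieldIterUniformAllL` — THE DERIVATIVE ROW OF THE (FL) NEWTON ROUTE, `k`-UNIFORM AT **EVERY** BLOCK SIZE `L ≥ 2`: ★w1 g0's R3
# `EMLTwoField.norm_iter_sub_iter_sub_iterLin_le_uniform` (`‖(Ū₁^{(s)} − Ū₂^{(s)})(c) − Q^{(s)}(U₁ − U₂)(c)‖ ≤ C·m_s(ρ)(m_s(ρ) + m_s(δ))`) WITHOUT the proviso `d + 2 ≤ L` —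
# Duhamel propagation through ★w2 g2's sup-small exact lift `liftS`, as in the companion `…EMLIterFirstOrderUniformAllL` (p593768) — so that the C^{1,1} constant of the `k`-fold
# (0.4) average which the `hLift`∕KIN contraction consumes is available at `L = 3`, which `HistoryTailL` ∕ `FluctuationComparisonRegPrIntL` ∕ 2′χ need (`∀ odd L > 1`) — cell `ym3-torus`,
# width seat `ym-ust-19936-w5` (g0); this seat's LOCATED NOTE 2026-08-28T01:21Z

WHY ∕ HOW.  As in the companion file: ★w1's R3 (p592571) propagates the two-field remainder `G_s = (Ū₁ − Ū₂)^{(s)} − Q^{(s)}Z` one step at a time (`G_{s+1} = Q₁G_s + T_s`, `T_s` the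
two-field Prop. 3 error `‖T_s‖ ≤ 1300ℓ²(2m_s(ρ))(2m_s(ρ) + 2m_s(δ))`, ★w1's R2 `EMLTwoField.norm_rem_sub_rem_le`) and needs `(d+1)L ≤ L²` (`step_dominates₂`).  Here `G_s = Q^{(s)}Γ_s` with
`Γ_{s+1} := Γ_s + liftS_{s+1}(T_s)` on the finest lattice (exactness `linAvgIterM_byEntry_liftS`, sup bound `norm_byEntry_liftS_le`), `‖Γ_s‖ ≤ E·X_s/L^s`, `X_s = m_s(ρ)(m_s(ρ) + m_s(δ))`
(`X_{s+1} = L²X_s`), `E = 18^d(2+(d+1)18^d)·5200ℓ²/(L(L−1))` propagating exactly, and `‖G_s‖ ≤ (d+1)L^s·E·X_s/L^s = C₂·X_s`, `C₂ = (d+1)E`; the background `U₂` through the levels is the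
companion's `norm_iter_sub_one_sub_iterLin_le_uniform_allL`.  All constants are GENERALISED inside the proof (opaque reals with defining equations), so the kernel never unfolds them.
WHAT IS HERE (no definition).  ★★ `norm_iter_sub_iter_sub_iterLin_le_uniform_allL`: for `SU(N)` fields `U₁, U₂` on the finest lattice with `‖U₂,b − 1‖ ≤ δ`, `‖U₁,b − U₂,b‖ ≤ ρ`, any family `Q`
of composites of `linAvg`, `k ≤ m + K`, scales `m_s(x) := (d+1)·L^s·x` (no group-dimension factor), and the four smallness rows `C₁·m_k(δ) ≤ 1` (`C₁` the companion's constant),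
`200ℓ·(m_k(ρ) + m_k(δ)) ≤ 1`, `C₂·(m_k(ρ) + m_k(δ)) ≤ 1`, `4ℓ·(m_k(ρ) + m_k(δ)) < δ_N`: for every `s ≤ k` and level-`s` bond `c`, `‖Ū₁^{(s)}(c) − Ū₂^{(s)}(c)‖ ≤ 2m_s(ρ)` and
`‖(Ū₁^{(s)}(c) − Ū₂^{(s)}(c)) − (Q^{(s)}(U₁ − U₂))(c)‖ ≤ C₂·m_s(ρ)·(m_s(ρ) + m_s(δ))` — NO condition on `L` beyond `L ≥ 2`.
HONEST FRAMING.  Flat reference as R3; kernel bookkeeping over landed lemmas (★w1's R2 two-field Prop. 3, ★w1∕★w3 sup bounds, ★w2 g2's `liftS`, the companion R1-allL); count-neutral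
helper toward R3 2′∕2′χ (FL) (`--supports stmt-QuantumFields-19936`); (FL), `hLift`, KIN are NOT proved here; registry untouched; nothing about d = 4, the continuum, or a mass gap;
YM₃ on T³ is rung R3, not Clay.

References: T. Bałaban, Commun. Math. Phys. 98 (1985) 17–51 [Balaban1985Averaging] (Prop. 3 (122)–(123) p.36, (127)–(133) pp.37–38, Prop. 4 (134)–(135) p.38, Prop. 5 (156)–(157)
p.42); Commun. Math. Phys. 109 (1987) 249–301 [Balaban1987RG1] ((0.4), (0.11) p.253).
-/

set_option autoImplicit false

noncomputable section

namespace Summit.QuantumFields.YangMills.Theorems.EMLIterUniformAllL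

open Finset
open scoped Matrix.Norms.L2Operator
open Literature.MathematicalPhysics.QuantumFieldTheory.Balaban1983to89
open T4Continuum AveragingRT BlockAveraging ExpMeanLog BlockAveragingEMLLinearised
open Summit.QuantumFields.YangMills.Theorems.Prop7LinAvgOnto (linAvg_add)
open Summit.QuantumFields.YangMills.Theorems.Prop7AvgLinearisation (iter_zero_apply' iter_succ_eq_avgFun' linAvg_sub)
open Summit.QuantumFields.YangMills.Theorems.LinearLiftMatrix (byEntry linAvgIterM linAvgIterM_zero linAvgIterM_succ norm_linAvgIterM_le norm_iterLin_le')
open Summit.QuantumFields.YangMills.Theorems.LinearLiftSpread (liftS)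
open Summit.QuantumFields.YangMills.Theorems.EMLTwoField (norm_rem_sub_rem_le)

variable {P : Params} {n : Type*} [Fintype n] [DecidableEq n] [Nonempty n]
set_option maxHeartbeats 400000 in
/-- ★★ **THE DERIVATIVE ROW, `k`-UNIFORM, AT EVERY BLOCK SIZE `L ≥ 2`** (★w1's `EMLTwoField.norm_iter_sub_iter_sub_iterLin_le_uniform` without `d + 2 ≤ L`; scales `m_s(x) = (d+1)L^s x`,
constant `C₂ = (d+1)·18^d(2+(d+1)18^d)·5200ℓ²/(L(L−1))`): `‖Ū₁^{(s)}(c) − Ū₂^{(s)}(c)‖ ≤ 2m_s(ρ)` and `‖(Ū₁^{(s)} − Ū₂^{(s)})(c) − (Q^{(s)}(U₁ − U₂))(c)‖ ≤ C₂·m_s(ρ)(m_s(ρ) + m_s(δ))` for all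
`s ≤ k ≤ m + K`, under the four smallness rows of the module docstring — the `k`-fold (0.4) average is C^{1,1} on the natural scales with NO `k` and NO `L`-threshold in the constant.
Duhamel induction: `(Ū₁ − Ū₂)^{(s)} − Q^{(s)}Z = Q^{(s)}Γ_s`, `Γ_{s+1} = Γ_s + liftS_{s+1}(T_s)`, `‖Γ_s‖ ≤ E·m_s(ρ)(m_s(ρ)+m_s(δ))/L^s`.
[cite: Balaban1985Averaging, Prop. 4 (134)–(135) p.38, (127)–(133) pp.37–38, Prop. 5 (156)–(157) p.42; Balaban1987RG1, (0.4)+(0.11) p.253] -/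
theorem norm_iter_sub_iter_sub_iterLin_le_uniform_allL
    (Q : (i : ℕ) → (PBond P 0 → Matrix n n ℂ) → PBond P i → Matrix n n ℂ)
    (hQ0 : ∀ Y, Q 0 Y = Y) (hQs : ∀ (i : ℕ) (Y : PBond P 0 → Matrix n n ℂ) (c : PBond P (i + 1)), Q (i + 1) Y c = linAvg (Q i Y) c)
    (U₁ U₂ : GaugeField P 0 (Matrix.specialUnitaryGroup n ℂ)) {δ ρ : ℝ} (hδ : 0 ≤ δ) (hρ0 : 0 ≤ ρ)
    (hU₂ : ∀ b, ‖((U₂ b : Matrix.specialUnitaryGroup n ℂ) : Matrix n n ℂ) - 1‖ ≤ δ)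
    (hρ : ∀ b, ‖((U₁ b : Matrix.specialUnitaryGroup n ℂ) : Matrix n n ℂ) - ((U₂ b : Matrix.specialUnitaryGroup n ℂ) : Matrix n n ℂ)‖ ≤ ρ)
    (k : ℕ) (hk : k ≤ P.m + P.K)
    (hmδ : (((P.d : ℝ) + 1) * ((18 : ℝ) ^ P.d * (2 + ((P.d : ℝ) + 1) * (18 : ℝ) ^ P.d)) * (324 * (((P.d + 2) * P.L : ℕ) : ℝ) ^ 2) /
        ((P.L : ℝ) * ((P.L : ℝ) - 1))) * (((P.d : ℝ) + 1) * (P.L : ℝ) ^ k * δ) ≤ 1)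
    (h200 : 200 * (((P.d + 2) * P.L : ℕ) : ℝ) * (((P.d : ℝ) + 1) * (P.L : ℝ) ^ k * ρ + ((P.d : ℝ) + 1) * (P.L : ℝ) ^ k * δ) ≤ 1)
    (hm : (((P.d : ℝ) + 1) * ((18 : ℝ) ^ P.d * (2 + ((P.d : ℝ) + 1) * (18 : ℝ) ^ P.d)) * (5200 * (((P.d + 2) * P.L : ℕ) : ℝ) ^ 2) /
        ((P.L : ℝ) * ((P.L : ℝ) - 1))) * (((P.d : ℝ) + 1) * (P.L : ℝ) ^ k * ρ + ((P.d : ℝ) + 1) * (P.L : ℝ) ^ k * δ) ≤ 1)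
    (hN : 4 * (((P.d + 2) * P.L : ℕ) : ℝ) * (((P.d : ℝ) + 1) * (P.L : ℝ) ^ k * ρ + ((P.d : ℝ) + 1) * (P.L : ℝ) ^ k * δ) < deltaSU n) :
    ∀ s : ℕ, s ≤ k → ∀ c : PBond P s,
      ‖((Averaging.iter (fun i => blockAvg (P := P) (j := i) (expMeanLogSU (n := n))) s U₁ c : Matrix.specialUnitaryGroup n ℂ) : Matrix n n ℂ) -
          ((Averaging.iter (fun i => blockAvg (P := P) (j := i) (expMeanLogSU (n := n))) s U₂ c : Matrix.specialUnitaryGroup n ℂ) : Matrix n n ℂ)‖ ≤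
          2 * (((P.d : ℝ) + 1) * (P.L : ℝ) ^ s * ρ) ∧
      ‖((Averaging.iter (fun i => blockAvg (P := P) (j := i) (expMeanLogSU (n := n))) s U₁ c : Matrix.specialUnitaryGroup n ℂ) : Matrix n n ℂ) -
          ((Averaging.iter (fun i => blockAvg (P := P) (j := i) (expMeanLogSU (n := n))) s U₂ c : Matrix.specialUnitaryGroup n ℂ) : Matrix n n ℂ) -
          Q s (fun b => ((U₁ b : Matrix.specialUnitaryGroup n ℂ) : Matrix n n ℂ) - ((U₂ b : Matrix.specialUnitaryGroup n ℂ) : Matrix n n ℂ)) c‖ ≤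
        (((P.d : ℝ) + 1) * ((18 : ℝ) ^ P.d * (2 + ((P.d : ℝ) + 1) * (18 : ℝ) ^ P.d)) * (5200 * (((P.d + 2) * P.L : ℕ) : ℝ) ^ 2) /
          ((P.L : ℝ) * ((P.L : ℝ) - 1))) *
          ((((P.d : ℝ) + 1) * (P.L : ℝ) ^ s * ρ) * ((((P.d : ℝ) + 1) * (P.L : ℝ) ^ s * ρ) + (((P.d : ℝ) + 1) * (P.L : ℝ) ^ s * δ))) := by
  -- sizes that do not need letters
  have hL1 : (1 : ℝ) < P.L := by exact_mod_cast P.hL.2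
  have hL0 : (0 : ℝ) < P.L := by linarith
  have hLL : 0 < (P.L : ℝ) * ((P.L : ℝ) - 1) := mul_pos hL0 (by linarith)
  have hd0 : (0 : ℝ) ≤ P.d := Nat.cast_nonneg _
  have hcast0 : (0 : ℝ) ≤ (((P.d + 2) * P.L : ℕ) : ℝ) := Nat.cast_nonneg _
  have hmkρ0 : 0 ≤ ((P.d : ℝ) + 1) * (P.L : ℝ) ^ k * ρ := by positivity
  have hmkδ0 : 0 ≤ ((P.d : ℝ) + 1) * (P.L : ℝ) ^ k * δ := by positivity
  -- the background `U₂` through the levels (flat Prop. 4, k-uniform at every `L`; called on the RAW hypotheses)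
  have h32δ : 32 * (((P.d + 2) * P.L : ℕ) : ℝ) * (((P.d : ℝ) + 1) * (P.L : ℝ) ^ k * δ) ≤ 1 := by
    have h1 : 32 * (((P.d + 2) * P.L : ℕ) : ℝ) * (((P.d : ℝ) + 1) * (P.L : ℝ) ^ k * δ) ≤
        200 * (((P.d + 2) * P.L : ℕ) : ℝ) * (((P.d : ℝ) + 1) * (P.L : ℝ) ^ k * δ) :=
      mul_le_mul_of_nonneg_right (by nlinarith [hcast0]) hmkδ0
    have h2 : 200 * (((P.d + 2) * P.L : ℕ) : ℝ) * (((P.d : ℝ) + 1) * (P.L : ℝ) ^ k * δ) ≤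
        200 * (((P.d + 2) * P.L : ℕ) : ℝ) * (((P.d : ℝ) + 1) * (P.L : ℝ) ^ k * ρ + ((P.d : ℝ) + 1) * (P.L : ℝ) ^ k * δ) :=
      mul_le_mul_of_nonneg_left (by linarith) (by positivity)
    exact h1.trans (h2.trans h200)
  have hNδ : 4 * (((P.d + 2) * P.L : ℕ) : ℝ) * (((P.d : ℝ) + 1) * (P.L : ℝ) ^ k * δ) < deltaSU n := by
    have h2 : 4 * (((P.d + 2) * P.L : ℕ) : ℝ) * (((P.d : ℝ) + 1) * (P.L : ℝ) ^ k * δ) ≤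
        4 * (((P.d + 2) * P.L : ℕ) : ℝ) * (((P.d : ℝ) + 1) * (P.L : ℝ) ^ k * ρ + ((P.d : ℝ) + 1) * (P.L : ℝ) ^ k * δ) :=
      mul_le_mul_of_nonneg_left (by linarith) (by positivity)
    exact h2.trans_lt hN
  have hbg := norm_iter_sub_one_sub_iterLin_le_uniform_allL Q hQ0 hQs U₂ hδ hU₂ k hk hmδ h32δ hNδ
  -- letters, GENERALISED (opaque reals with defining equations: no definitional unfolding of the constants is ever needed)
  obtain ⟨ℓ, hℓ⟩ : ∃ x : ℝ, x = (((P.d + 2) * P.L : ℕ) : ℝ) := ⟨_, rfl⟩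
  obtain ⟨CS, hCS⟩ : ∃ x : ℝ, x = (18 : ℝ) ^ P.d * (2 + ((P.d : ℝ) + 1) * (18 : ℝ) ^ P.d) := ⟨_, rfl⟩
  rw [← hℓ] at h200 hm hN
  rw [← hCS] at hm
  simp only [← hℓ, ← hCS]
  obtain ⟨E, hE⟩ : ∃ x : ℝ, x = CS * (5200 * ℓ ^ 2) / ((P.L : ℝ) * ((P.L : ℝ) - 1)) := ⟨_, rfl⟩
  obtain ⟨C, hC⟩ : ∃ x : ℝ, x = ((P.d : ℝ) + 1) * CS * (5200 * ℓ ^ 2) / ((P.L : ℝ) * ((P.L : ℝ) - 1)) := ⟨_, rfl⟩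
  rw [← hC] at hm
  simp only [← hC]
  set Z : PBond P 0 → Matrix n n ℂ := fun b => ((U₁ b : Matrix.specialUnitaryGroup n ℂ) : Matrix n n ℂ) - ((U₂ b : Matrix.specialUnitaryGroup n ℂ) : Matrix n n ℂ) with hZ
  let mρ : ℕ → ℝ := fun s => ((P.d : ℝ) + 1) * (P.L : ℝ) ^ s * ρ
  let mδ : ℕ → ℝ := fun s => ((P.d : ℝ) + 1) * (P.L : ℝ) ^ s * δ
  have hmρ_def : ∀ s, mρ s = ((P.d : ℝ) + 1) * (P.L : ℝ) ^ s * ρ := fun s => rfl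
  have hmδ_def : ∀ s, mδ s = ((P.d : ℝ) + 1) * (P.L : ℝ) ^ s * δ := fun s => rfl
  have hℓ0 : 0 ≤ ℓ := by rw [hℓ]; exact Nat.cast_nonneg _
  have hCS0 : 0 ≤ CS := by rw [hCS]; positivity
  have hE0 : 0 ≤ E := by rw [hE]; positivity
  have hC0 : 0 ≤ C := by rw [hC]; positivity
  have hCE : C = ((P.d : ℝ) + 1) * E := by rw [hC, hE]; ring
  have hmρ0 : ∀ s, 0 ≤ mρ s := fun s => by rw [hmρ_def]; positivity
  have hmδ0 : ∀ s, 0 ≤ mδ s := fun s => by rw [hmδ_def]; positivity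
  have hmρsucc : ∀ s, mρ (s + 1) = (P.L : ℝ) * mρ s := fun s => by rw [hmρ_def, hmρ_def, pow_succ]; ring
  have hmδsucc : ∀ s, mδ (s + 1) = (P.L : ℝ) * mδ s := fun s => by rw [hmδ_def, hmδ_def, pow_succ]; ring
  have hmono_aux : ∀ {x : ℝ}, 0 ≤ x → ∀ s, s ≤ k → ((P.d : ℝ) + 1) * (P.L : ℝ) ^ s * x ≤ ((P.d : ℝ) + 1) * (P.L : ℝ) ^ k * x := fun hx s hs => by
    have hpow : (P.L : ℝ) ^ s ≤ (P.L : ℝ) ^ k := pow_le_pow_right₀ hL1.le hs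
    exact mul_le_mul_of_nonneg_right (mul_le_mul_of_nonneg_left hpow (by positivity)) hx
  have hmonoρ : ∀ s, s ≤ k → mρ s ≤ mρ k := fun s hs => hmono_aux hρ0 s hs
  have hmonoδ : ∀ s, s ≤ k → mδ s ≤ mδ k := fun s hs => hmono_aux hδ s hs
  have hZρ : ∀ b, ‖Z b‖ ≤ ρ := hρ
  -- the main term on its natural scale
  have hmain : ∀ (s : ℕ) (c : PBond P s), ‖Q s Z c‖ ≤ mρ s := fun s c => by
    have h := norm_iterLin_le' Q hQ0 hQs Z hZρ s c
    rwa [hmρ_def]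
  -- the geometric bookkeeping of the Duhamel bound
  have hEL : E * ((P.L : ℝ) * ((P.L : ℝ) - 1)) = CS * (5200 * ℓ ^ 2) := by rw [hE]; exact div_mul_cancel₀ _ hLL.ne'
  have hEL2 : E * (P.L : ℝ) + CS * (5200 * ℓ ^ 2) = E * (P.L : ℝ) ^ 2 := by linear_combination (-1 : ℝ) * hEL
  have hstep : ∀ s : ℕ, E * (mρ s * (mρ s + mδ s)) / (P.L : ℝ) ^ s + CS * (5200 * ℓ ^ 2 * (mρ s * (mρ s + mδ s))) / (P.L : ℝ) ^ (s + 1) =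
      E * (mρ (s + 1) * (mρ (s + 1) + mδ (s + 1))) / (P.L : ℝ) ^ (s + 1) := fun s => by
    have hLs : (P.L : ℝ) ^ s ≠ 0 := (pow_pos hL0 s).ne'
    have hL0' : (P.L : ℝ) ≠ 0 := hL0.ne'
    calc E * (mρ s * (mρ s + mδ s)) / (P.L : ℝ) ^ s + CS * (5200 * ℓ ^ 2 * (mρ s * (mρ s + mδ s))) / (P.L : ℝ) ^ (s + 1)
        = (E * (P.L : ℝ) + CS * (5200 * ℓ ^ 2)) * (mρ s * (mρ s + mδ s)) / (P.L : ℝ) ^ (s + 1) := by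
          rw [pow_succ]; field_simp; ring
      _ = (E * (P.L : ℝ) ^ 2) * (mρ s * (mρ s + mδ s)) / (P.L : ℝ) ^ (s + 1) := by rw [hEL2]
      _ = E * (mρ (s + 1) * (mρ (s + 1) + mδ (s + 1))) / (P.L : ℝ) ^ (s + 1) := by rw [hmρsucc, hmδsucc]; ring
  -- the induction, Duhamel form: `Ū₁^{(s)} − Ū₂^{(s)} − Q^{(s)}Z = Q^{(s)}Γ_s`, `‖Γ_s‖ ≤ E·X_s/L^s`, `X_s = mρ_s(mρ_s + mδ_s)`
  have key : ∀ s : ℕ, s ≤ k → ∃ Γ : PBond P 0 → Matrix n n ℂ, (∀ b, ‖Γ b‖ ≤ E * (mρ s * (mρ s + mδ s)) / (P.L : ℝ) ^ s) ∧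
      ∀ c : PBond P s, ((Averaging.iter (fun i => blockAvg (P := P) (j := i) (expMeanLogSU (n := n))) s U₁ c : Matrix.specialUnitaryGroup n ℂ) : Matrix n n ℂ) - ((Averaging.iter (fun i => blockAvg (P := P) (j := i) (expMeanLogSU (n := n))) s U₂ c : Matrix.specialUnitaryGroup n ℂ) : Matrix n n ℂ) - Q s Z c = linAvgIterM s Γ c := by
    intro s
    induction s with
    | zero =>
      intro _
      refine ⟨fun _ => 0, fun b => by rw [norm_zero]; positivity, fun c => ?_⟩
      rw [iter_zero_apply', iter_zero_apply', hQ0, linAvgIterM_zero, sub_self]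
    | succ s ih =>
      intro hsk
      have hs : s ≤ k := (Nat.le_succ s).trans hsk
      obtain ⟨Γ, hΓ, hrep⟩ := ih hs
      -- sizes at level `s`
      have hLs : (0 : ℝ) < (P.L : ℝ) ^ s := pow_pos hL0 s
      have hGs : ∀ c : PBond P s, ‖linAvgIterM s Γ c‖ ≤ C * (mρ s * (mρ s + mδ s)) := fun c => by
        have h := norm_linAvgIterM_le s Γ hΓ c
        calc ‖linAvgIterM s Γ c‖ ≤ ((P.d : ℝ) + 1) * (P.L : ℝ) ^ s * (E * (mρ s * (mρ s + mδ s)) / (P.L : ℝ) ^ s) := h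
          _ = C * (mρ s * (mρ s + mδ s)) := by rw [hCE]; field_simp
      have hCm : C * (mρ s + mδ s) ≤ 1 := (mul_le_mul_of_nonneg_left (add_le_add (hmonoρ s hs) (hmonoδ s hs)) hC0).trans hm
      have hGm : C * (mρ s * (mρ s + mδ s)) ≤ mρ s := by
        have : C * (mρ s * (mρ s + mδ s)) = (C * (mρ s + mδ s)) * mρ s := by ring
        rw [this]; exact (mul_le_mul_of_nonneg_right hCm (hmρ0 s)).trans_eq (one_mul _)
      set W₁ : GaugeField P s (Matrix.specialUnitaryGroup n ℂ) := Averaging.iter (fun i => blockAvg (P := P) (j := i) (expMeanLogSU (n := n))) s U₁ with hW₁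
      set W₂ : GaugeField P s (Matrix.specialUnitaryGroup n ℂ) := Averaging.iter (fun i => blockAvg (P := P) (j := i) (expMeanLogSU (n := n))) s U₂ with hW₂
      have hW₂1 : ∀ b, ‖((W₂ b : Matrix.specialUnitaryGroup n ℂ) : Matrix n n ℂ) - 1‖ ≤ 2 * mδ s := fun b => (hbg s hs b).1
      have hρs : ∀ b, ‖((W₁ b : Matrix.specialUnitaryGroup n ℂ) : Matrix n n ℂ) - ((W₂ b : Matrix.specialUnitaryGroup n ℂ) : Matrix n n ℂ)‖ ≤ 2 * mρ s := fun b => by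
        have e : ((W₁ b : Matrix.specialUnitaryGroup n ℂ) : Matrix n n ℂ) - ((W₂ b : Matrix.specialUnitaryGroup n ℂ) : Matrix n n ℂ) = Q s Z b + linAvgIterM s Γ b := by
          rw [← hrep b, add_sub_cancel]
        rw [e]
        exact (norm_add_le _ _).trans (by linarith [hmain s b, hGs b, hGm])
      -- the two-field one-step hypotheses at scales `2mδ s`, `2mρ s` (in the RAW cast form the one-step lemma wants)
      have h2δ0 : 0 ≤ 2 * mδ s := by linarith [hmδ0 s]
      have h2ρ0 : 0 ≤ 2 * mρ s := by linarith [hmρ0 s]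
      have h200s : 200 * ℓ * (mρ s + mδ s) ≤ 1 :=
        (mul_le_mul_of_nonneg_left (add_le_add (hmonoρ s hs) (hmonoδ s hs)) (by positivity)).trans h200
      have hℓ200 : (0 : ℝ) ≤ 200 * ℓ := by positivity
      have h100 : 100 * ((((P.d + 2) * P.L : ℕ) : ℝ) * (2 * mδ s)) ≤ 1 := by
        rw [← hℓ]
        have e1 : 100 * (ℓ * (2 * mδ s)) = 200 * ℓ * mδ s := by ring
        rw [e1]
        exact (mul_le_mul_of_nonneg_left (by linarith [hmρ0 s] : mδ s ≤ mρ s + mδ s) hℓ200).trans h200s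
      have h48 : 48 * ((((P.d + 2) * P.L : ℕ) : ℝ) * (2 * mρ s)) ≤ 1 := by
        rw [← hℓ]
        have e1 : 48 * (ℓ * (2 * mρ s)) = 96 * ℓ * mρ s := by ring
        rw [e1]
        have h96 : 96 * ℓ * mρ s ≤ 200 * ℓ * mρ s := mul_le_mul_of_nonneg_right (by nlinarith [hℓ0]) (hmρ0 s)
        exact h96.trans ((mul_le_mul_of_nonneg_left (by linarith [hmδ0 s] : mρ s ≤ mρ s + mδ s) hℓ200).trans h200s)
      have hNs : 2 * ((((P.d + 2) * P.L : ℕ) : ℝ) * (2 * mρ s)) + 2 * ((((P.d + 2) * P.L : ℕ) : ℝ) * (2 * mδ s)) < deltaSU n := by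
        rw [← hℓ]
        have e1 : 2 * (ℓ * (2 * mρ s)) + 2 * (ℓ * (2 * mδ s)) = 4 * ℓ * (mρ s + mδ s) := by ring
        rw [e1]
        have h4 : 4 * ℓ * (mρ s + mδ s) ≤ 4 * ℓ * (mρ k + mδ k) :=
          mul_le_mul_of_nonneg_left (add_le_add (hmonoρ s hs) (hmonoδ s hs)) (by positivity)
        exact h4.trans_lt hN
      -- the NEW two-field error `T_s`
      set T : PBond P (s + 1) → Matrix n n ℂ := fun c =>
        (((avgFun (expMeanLogSU (n := n)) W₁ c : Matrix.specialUnitaryGroup n ℂ) : Matrix n n ℂ) - 1 -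
            linAvg (fun b => ((W₁ b : Matrix.specialUnitaryGroup n ℂ) : Matrix n n ℂ) - 1) c) -
          (((avgFun (expMeanLogSU (n := n)) W₂ c : Matrix.specialUnitaryGroup n ℂ) : Matrix n n ℂ) - 1 -
            linAvg (fun b => ((W₂ b : Matrix.specialUnitaryGroup n ℂ) : Matrix n n ℂ) - 1) c) with hT
      have hTb : ∀ c, ‖T c‖ ≤ 5200 * ℓ ^ 2 * (mρ s * (mρ s + mδ s)) := fun c => by
        have htwo := norm_rem_sub_rem_le (n := n) W₁ W₂ h2δ0 h2ρ0 hW₂1 hρs h100 h48 hNs c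
        rw [← hℓ] at htwo
        calc ‖T c‖ ≤ 1300 * ℓ ^ 2 * (2 * mρ s) * (2 * mρ s + 2 * mδ s) := htwo
          _ = 5200 * ℓ ^ 2 * (mρ s * (mρ s + mδ s)) := by ring
      -- the Duhamel update `Γ' := Γ + liftS_{s+1}(T_s)`
      refine ⟨fun b => Γ b + byEntry (liftS (s + 1)) T b, fun b => ?_, fun c => ?_⟩
      · have h1 := hΓ b
        have h2 := norm_byEntry_liftS_le (s + 1) (hsk.trans hk) T hTb b
        rw [← hCS] at h2
        calc ‖Γ b + byEntry (liftS (s + 1)) T b‖ ≤ ‖Γ b‖ + ‖byEntry (liftS (s + 1)) T b‖ := norm_add_le _ _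
          _ ≤ E * (mρ s * (mρ s + mδ s)) / (P.L : ℝ) ^ s + CS / (P.L : ℝ) ^ (s + 1) * (5200 * ℓ ^ 2 * (mρ s * (mρ s + mδ s))) := add_le_add h1 h2
          _ = E * (mρ s * (mρ s + mδ s)) / (P.L : ℝ) ^ s + CS * (5200 * ℓ ^ 2 * (mρ s * (mρ s + mδ s))) / (P.L : ℝ) ^ (s + 1) := by ring
          _ = E * (mρ (s + 1) * (mρ (s + 1) + mδ (s + 1))) / (P.L : ℝ) ^ (s + 1) := hstep s
      · -- `(Ū₁ − Ū₂)^{(s+1)} − Q^{(s+1)}Z = Q₁(Q^{(s)}Γ) + T_s = Q^{(s+1)}Γ'`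
        have hsplit : linAvg (fun b => ((W₁ b : Matrix.specialUnitaryGroup n ℂ) : Matrix n n ℂ) - 1) c -
            linAvg (fun b => ((W₂ b : Matrix.specialUnitaryGroup n ℂ) : Matrix n n ℂ) - 1) c = Q (s + 1) Z c + linAvgIterM (s + 1) Γ c := by
          rw [← linAvg_sub]
          have e : (fun b => (((W₁ b : Matrix.specialUnitaryGroup n ℂ) : Matrix n n ℂ) - 1) - (((W₂ b : Matrix.specialUnitaryGroup n ℂ) : Matrix n n ℂ) - 1)) =
              fun b => Q s Z b + linAvgIterM s Γ b := by
            funext b; rw [sub_sub_sub_cancel_right, ← hrep b, add_sub_cancel]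
          rw [e, linAvg_add, hQs, linAvgIterM_succ]
        rw [iter_succ_eq_avgFun', iter_succ_eq_avgFun', linAvgIterM_add, linAvgIterM_byEntry_liftS (s + 1) (hsk.trans hk) T]
        set A₁ : Matrix n n ℂ := ((avgFun (expMeanLogSU (n := n)) W₁ c : Matrix.specialUnitaryGroup n ℂ) : Matrix n n ℂ)
        set A₂ : Matrix n n ℂ := ((avgFun (expMeanLogSU (n := n)) W₂ c : Matrix.specialUnitaryGroup n ℂ) : Matrix n n ℂ)
        have e2 : A₁ - A₂ - Q (s + 1) Z c =
            ((A₁ - 1 - linAvg (fun b => ((W₁ b : Matrix.specialUnitaryGroup n ℂ) : Matrix n n ℂ) - 1) c) -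
              (A₂ - 1 - linAvg (fun b => ((W₂ b : Matrix.specialUnitaryGroup n ℂ) : Matrix n n ℂ) - 1) c)) + linAvgIterM (s + 1) Γ c := by
          have e3 : Q (s + 1) Z c = (linAvg (fun b => ((W₁ b : Matrix.specialUnitaryGroup n ℂ) : Matrix n n ℂ) - 1) c -
              linAvg (fun b => ((W₂ b : Matrix.specialUnitaryGroup n ℂ) : Matrix n n ℂ) - 1) c) - linAvgIterM (s + 1) Γ c := by rw [hsplit]; abel
          rw [e3]; abel
        rw [e2, hT, add_comm]
  -- the remainder bound, read off the Duhamel representation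
  have key2 : ∀ s : ℕ, s ≤ k → ∀ c : PBond P s, ‖((Averaging.iter (fun i => blockAvg (P := P) (j := i) (expMeanLogSU (n := n))) s U₁ c : Matrix.specialUnitaryGroup n ℂ) : Matrix n n ℂ) - ((Averaging.iter (fun i => blockAvg (P := P) (j := i) (expMeanLogSU (n := n))) s U₂ c : Matrix.specialUnitaryGroup n ℂ) : Matrix n n ℂ) - Q s Z c‖ ≤ C * (mρ s * (mρ s + mδ s)) := by
    intro s hs c
    obtain ⟨Γ, hΓ, hrep⟩ := key s hs
    have hLs : (0 : ℝ) < (P.L : ℝ) ^ s := pow_pos hL0 s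
    rw [hrep c]
    calc ‖linAvgIterM s Γ c‖ ≤ ((P.d : ℝ) + 1) * (P.L : ℝ) ^ s * (E * (mρ s * (mρ s + mδ s)) / (P.L : ℝ) ^ s) := norm_linAvgIterM_le s Γ hΓ c
      _ = C * (mρ s * (mρ s + mδ s)) := by rw [hCE]; field_simp
  -- assemble
  intro s hs c
  have h2 := key2 s hs c
  refine ⟨?_, h2⟩
  have hCm : C * (mρ s + mδ s) ≤ 1 := (mul_le_mul_of_nonneg_left (add_le_add (hmonoρ s hs) (hmonoδ s hs)) hC0).trans hm
  have hGm : C * (mρ s * (mρ s + mδ s)) ≤ mρ s := by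
    have : C * (mρ s * (mρ s + mδ s)) = (C * (mρ s + mδ s)) * mρ s := by ring
    rw [this]; exact (mul_le_mul_of_nonneg_right hCm (hmρ0 s)).trans_eq (one_mul _)
  have e : ((Averaging.iter (fun i => blockAvg (P := P) (j := i) (expMeanLogSU (n := n))) s U₁ c : Matrix.specialUnitaryGroup n ℂ) : Matrix n n ℂ) - ((Averaging.iter (fun i => blockAvg (P := P) (j := i) (expMeanLogSU (n := n))) s U₂ c : Matrix.specialUnitaryGroup n ℂ) : Matrix n n ℂ) = Q s Z c + (((Averaging.iter (fun i => blockAvg (P := P) (j := i) (expMeanLogSU (n := n))) s U₁ c : Matrix.specialUnitaryGroup n ℂ) : Matrix n n ℂ) - ((Averaging.iter (fun i => blockAvg (P := P) (j := i) (expMeanLogSU (n := n))) s U₂ c : Matrix.specialUnitaryGroup n ℂ) : Matrix n n ℂ) - Q s Z c) := by abel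
  rw [e]
  exact (norm_add_le _ _).trans (by linarith [hmain s c])

end Summit.QuantumFields.YangMills.Theorems.EMLIterUniformAllL

end
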